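import Summits.NavierStokesRegularity.NavierStokesRegularity.Theses.SlicedKelvin
import Summits.NavierStokesRegularity.NavierStokesRegularity.Theorems.LiouvilleConjectureNS
import HarnessLib

/-!
# `SlicedKelvin.PlanarFluxLiouville` is a consequence of the KNSS Liouville conjecture (L)

(crux item `stmt-NavierStokesRegularity-15601`; CONDITIONAL bridge, recorded for the route's kill
criterion "KNSS (L) proved elsewhere closes crux 3 at once".)

The crux `PlanarFluxLiouville` (a bounded ancient mild solution of Navier–Stokes, `ν = 1`,
measurable slices, jointly smooth on `(−∞,0) × ℝ³`, with uniformly bounded unsigned vorticity flux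
through every plane, is spatially constant on every slice) is WEAKER than the Liouville conjecture
(L) of Koch–Nadirashvili–Seregin–Šverák (canonical statement
`Summit.NavierStokesRegularity.NavierStokesRegularity.LiouvilleConjectureNS`, item
`stmt-NavierStokesRegularity-10661`): (L) gives `v t = b` almost everywhere for every `t < 0`
without using the flux hypothesis at all, and joint smoothness makes the slice `v t` continuous, so
the a.e. identity holds everywhere. This file proves exactly that implication; it does NOT prove the
crux (the hypothesis `LiouvilleConjectureNS` is an open conjecture), it only makes the dependency
crux ⇐ (L) kernel-checked.
-/

noncomputable section

open Set MeasureTheory Filter Topology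
open Literature.Analysis.FluidPDE

-- single-conjunct summit: `<Summit>.<Problem>` repeats the name (tree-wide convention, lakefile weak option)
set_option linter.dupNamespace false

namespace Summit.NavierStokesRegularity.NavierStokesRegularity.Theorems

/-- **Crux 3 of route SlicedKelvin from the Liouville conjecture (L)** (conditional bridge):
`LiouvilleConjectureNS → Theses.SlicedKelvin.PlanarFluxLiouville`. Given a bounded ancient mild
solution `v` with measurable slices, (L) yields for each `t < 0` a constant `b` with `v t = b`
a.e.; the slice `v t` is smooth (joint smoothness composed with `x ↦ (t, x)`), hence continuous, and
two continuous functions that agree a.e. for Lebesgue measure agree everywhere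
(`Continuous.ae_eq_iff_eq`). The planar-flux hypothesis is not used. KNSS 2009, §1 (the
conjecture); the implication itself is elementary. -/
theorem slicedKelvin_planarFluxLiouville_of_liouvilleConjectureNS
    (hL : LiouvilleConjectureNS) : Theses.SlicedKelvin.PlanarFluxLiouville := by
  intro v hv hmeas hsm _ t ht
  obtain ⟨b, hb⟩ := hL v hv hmeas t ht
  have hincl : ∀ x : EuclideanSpace ℝ (Fin 3),
      ((t, x) : ℝ × EuclideanSpace ℝ (Fin 3)) ∈ Set.Iio (0 : ℝ) ×ˢ (Set.univ : Set (EuclideanSpace ℝ (Fin 3))) :=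
    fun x => Set.mk_mem_prod ht (Set.mem_univ x)
  have hvt : ContDiff ℝ (⊤ : ℕ∞) (v t) := hsm.comp_contDiff (contDiff_prodMk_right t) hincl
  have heq : v t = fun _ => b :=
    (Continuous.ae_eq_iff_eq volume hvt.continuous continuous_const).1 hb
  exact ⟨b, fun x => congrFun heq x⟩

end Summit.NavierStokesRegularity.NavierStokesRegularity.Theorems

end
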